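import Mathlib
import HarnessLib
import Literature.Computability.AlgebraicComplexity.AsymptoticSpectrum
import Literature.Computability.AlgebraicComplexity.AsymptoticSpectrumProofs
import Literature.Computability.AlgebraicComplexity.FlatteningRank
import Literature.Computability.AlgebraicComplexity.TensorSemiringSpectrum
import Literature.Computability.AlgebraicComplexity.DegenerationSpectralMonotone
import Literature.Computability.AlgebraicComplexity.AlmanLi2026SpectrumMatMul
import Summits.MatrixMultiplication.MatrixMultiplication.Theorems.OutsiderSandwichBlockOneOperational
import Summits.MatrixMultiplication.MatrixMultiplication.Theorems.OutsiderSandwichBlockSubrank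
import Summits.MatrixMultiplication.MatrixMultiplication.Theorems.OutsiderSandwichExchangeRate
import Summits.MatrixMultiplication.MatrixMultiplication.Theorems.OutsiderSandwichExchangeExponent

/-!
# Outsider sandwich — the SPECTRAL FORMULA for the exchange exponent (decomp-mm lens-4, g20; part 3)

Continues `OutsiderSandwichExchangeRate` / `OutsiderSandwichExchangeExponent` (`Helped`, `ExponentAchieved`,
`exchangeNumber = r`, `exchangeExponent = θ⋆`; `BlockOneIsMM ⟺ θ⋆ = 0`).  Here the extremal number gets its
DUAL side and a closed formula on the asymptotic spectrum.  Write `SpectralRatioLe θ :⟺ ∀ universal F,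
F⟨2,2,2⟩ ≤ 2^θ · F(C₁)` and `logRatio F := log₂ (F⟨2,2,2⟩ / F(C₁))`.  All hypothesis-free:
* §0 VALUES: at every universal point `4 ≤ F⟨2,2,2⟩ = 2^{θ₁+θ₂+θ₃} ≤ 2^ω` (Alman–Li coordinates, tree
  `map_matMulTensor_cube`, `prop42`, `four_le_map_matMulTensor_two`) and `4 ≤ F(C₁)` (lens-4 g17 `blockSubrankFull_holds`); at the GAUGE point
  `ζ⁽¹⁾` both values are `4` (tree `gaugePoint₁_matMulTensor_two`; `gaugePoint₁_coupling₁`), so `SpectralRatioLe θ ⟹ θ ≥ 0`.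
* §1 CERTIFICATES BOUND EVERY POINT: `Helped N B ⟹ F⟨2,2,2⟩^N ≤ B · F(C₁)^N`, hence
  **`(F⟨2,2,2⟩ / F(C₁))^N ≤ r(N)`** (`ratio_pow_le_exchangeNumber`) and `ExponentAchieved θ ⟹ SpectralRatioLe θ`:
  ONE universal point with `F⟨2,2,2⟩ > F(C₁)` forces the exchange numbers to grow exponentially.
* §2 STRASSEN DUALITY WITH RATES: `SpectralRatioLe θ ⟹ ExponentAchieved (θ + ε)` for every `ε > 0`
  (`exponentAchieved_of_spectralRatioLe`: the tree's spectral theorem in g19's cofinal form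
  `forall_universal_le_iff_cofinal`, applied to the pair `(⟨2,2,2⟩^{⊠q}, ⟨2^p⟩ ⊠ C₁^{⊠q})`, `θ ≤ p/q < θ + ε/2`).
* §3 THE FORMULA: `SpectralRatioLe` is closed from above, so **`∀ universal F, F⟨2,2,2⟩ ≤ 2^{θ⋆} F(C₁)`**,
  `θ⋆ = min {θ | SpectralRatioLe θ}` (`isLeast_exchangeExponent_spectral`) and
  **`θ⋆ = sup_F log₂ (F⟨2,2,2⟩ / F(C₁)) = sup_F [(θ₁+θ₂+θ₃)(F) − log₂ F(C₁)]`** over the universal spectral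
  points (`isLUB_exchangeExponent_logRatio`, `logRatio_eq_sum_specMMPoint_sub`).  THE LEAF IN COORDINATES:
  `BlockOneIsMM ⟺ ∀ universal F, θ₁+θ₂+θ₃ ≤ log₂ F(C₁)` (`blockOneIsMM_iff_forall_sum_specMMPoint_le`), while
  `ω = 2 ⟺ θ₁+θ₂+θ₃ ≡ 2` and `log₂ F(C₁) ≥ 2` always: a minimal counterexample to the leaf is a point of
  the Alman–Li spectrum of `⟨2,2,2⟩` with `θ₁+θ₂+θ₃ > log₂ F(C₁) (≥ 2)` (`not_blockOneIsMM_iff_exists_point`).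

[Strassen1988, Thm. 3.8, (3.10)]; [ChristandlVranaZuiddam2023, §1.2, Ex. 1.4]; [AlmanLi2026, Prop. 4.2];
[Zuiddam2018, §2.3].
-/

noncomputable section

open Filter Topology
open Literature.Computability.AlgebraicComplexity
open Summit.MatrixMultiplication.MatrixMultiplication.Theorems.OutsiderSandwichCoupling (coupling₁)
open Summit.MatrixMultiplication.MatrixMultiplication.Theorems.OutsiderSandwichExchangeRate
open Summit.MatrixMultiplication.MatrixMultiplication.Theorems.OutsiderSandwichExchangeExponent

namespace Summit.MatrixMultiplication.MatrixMultiplication.Theorems.OutsiderSandwichExchangeSpectral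

/-- **`SpectralRatioLe θ`**: every universal spectral point has `F⟨2,2,2⟩ ≤ 2^θ · F(C₁)`.
[cite: Strassen1988, Thm. 3.8] -/
def SpectralRatioLe (θ : ℝ) : Prop :=
  ∀ F : SpectralMap ℂ, IsUniversalSpectralPoint ℂ F →
    F (matMulTensor ℂ 2 2 2) ≤ (2 : ℝ) ^ θ * F coupling₁

/-- **`logRatio F = log₂ (F⟨2,2,2⟩ / F(C₁))`**. [cite: Strassen1988, Thm. 3.8] -/
def logRatio (F : SpectralMap ℂ) : ℝ :=
  Real.logb 2 (F (matMulTensor ℂ 2 2 2) / F coupling₁)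

/-! ## 0. Values at universal points -/

/-- `4 ≤ F(C₁)` at every universal point (lens-4 g17, `Q̃(C₁) = 4`). [cite: Strassen1991, Thm. 6.1] -/
theorem four_le_map_coupling₁ {F : SpectralMap ℂ} (hF : IsUniversalSpectralPoint ℂ F) :
    (4 : ℝ) ≤ F coupling₁ :=
  (OutsiderSandwichBlockSubrank.blockSubrankFull_holds F hF).1

/-- `F⟨2,2,2⟩ = 2^{θ₁+θ₂+θ₃}` in the Alman–Li coordinates of `F`. [cite: AlmanLi2026, Prop. 4.2] -/
theorem map_matMul_eq_rpow {F : SpectralMap ℂ} (hF : IsUniversalSpectralPoint ℂ F) :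
    F (matMulTensor ℂ 2 2 2) = (2 : ℝ) ^ ∑ i, specMMPoint ℂ F i := by
  have h := hF.map_matMulTensor_cube (n := 2) (by norm_num)
  exact_mod_cast h

/-- `F⟨2,2,2⟩ ≤ 2^ω` at every universal point. [cite: AlmanLi2026, Prop. 4.2] -/
theorem map_matMul_le_rpow_omega {F : SpectralMap ℂ} (hF : IsUniversalSpectralPoint ℂ F) :
    F (matMulTensor ℂ 2 2 2) ≤ (2 : ℝ) ^ omega ℂ := by
  rw [map_matMul_eq_rpow hF]
  exact Real.rpow_le_rpow_of_exponent_le (by norm_num) (AlmanLi2026.prop42_sum_le_omega hF)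

/-- The gauge point `ζ⁽¹⁾` takes the value `4` on `C₁` (`≤ 4`: a flattening of a `4 × 4 × 4` tensor,
tree `gaugePoint₁_le_four`; `≥ 4`: `BlockSubrankFull`); on `⟨2,2,2⟩` it is `4` as well
(tree `gaugePoint₁_matMulTensor_two`). [cite: ChristandlVranaZuiddam2023, Ex. 1.4] -/
theorem gaugePoint₁_coupling₁ : gaugePoint₁ ℂ coupling₁ = 4 :=
  le_antisymm (OutsiderSandwichCoupling.gaugePoint₁_le_four coupling₁)
    (four_le_map_coupling₁ (gaugePoint₁_isUniversalSpectralPoint ℂ))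

/-- `logRatio ζ⁽¹⁾ = 0`. [cite: ChristandlVranaZuiddam2023, Ex. 1.4] -/
theorem logRatio_gaugePoint₁ : logRatio (gaugePoint₁ ℂ) = 0 := by
  rw [logRatio, OutsiderSandwichContactFace.gaugePoint₁_matMulTensor_two, gaugePoint₁_coupling₁,
    div_self (by norm_num), Real.logb_one]

/-- **`SpectralRatioLe θ ⟹ 0 ≤ θ`** (test at the gauge point). [cite: ChristandlVranaZuiddam2023, Ex. 1.4] -/
theorem SpectralRatioLe.nonneg {θ : ℝ} (h : SpectralRatioLe θ) : 0 ≤ θ := by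
  have h4 := h _ (gaugePoint₁_isUniversalSpectralPoint ℂ)
  rw [OutsiderSandwichContactFace.gaugePoint₁_matMulTensor_two, gaugePoint₁_coupling₁] at h4
  by_contra hθ
  have : (2 : ℝ) ^ θ < 1 := Real.rpow_lt_one_of_one_lt_of_neg (by norm_num) (lt_of_not_ge hθ)
  linarith

/-- `SpectralRatioLe` is monotone in `θ`. [folklore] -/
theorem SpectralRatioLe.mono {θ θ' : ℝ} (h : SpectralRatioLe θ) (hle : θ ≤ θ') : SpectralRatioLe θ' :=
  fun F hF => (h F hF).trans (mul_le_mul_of_nonneg_right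
    (Real.rpow_le_rpow_of_exponent_le (by norm_num) hle) (hF.nonneg _))

/-- `SpectralRatioLe 0 ⟺ ∀ universal F, F⟨2,2,2⟩ ≤ F(C₁)`. [folklore] -/
theorem spectralRatioLe_zero_iff :
    SpectralRatioLe 0 ↔ ∀ F : SpectralMap ℂ, IsUniversalSpectralPoint ℂ F →
      F (matMulTensor ℂ 2 2 2) ≤ F coupling₁ := by
  simp only [SpectralRatioLe, Real.rpow_zero, one_mul]

/-- `logRatio F ≤ θ ⟺ F⟨2,2,2⟩ ≤ 2^θ F(C₁)`. [folklore] -/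
theorem logRatio_le_iff {F : SpectralMap ℂ} (hF : IsUniversalSpectralPoint ℂ F) {θ : ℝ} :
    logRatio F ≤ θ ↔ F (matMulTensor ℂ 2 2 2) ≤ (2 : ℝ) ^ θ * F coupling₁ := by
  have hC : (0 : ℝ) < F coupling₁ := lt_of_lt_of_le (by norm_num) (four_le_map_coupling₁ hF)
  have hM : (0 : ℝ) < F (matMulTensor ℂ 2 2 2) := lt_of_lt_of_le (by norm_num) (OutsiderSandwichEdgeRigidity.four_le_map_matMulTensor_two hF)
  rw [logRatio, Real.logb_le_iff_le_rpow (by norm_num) (div_pos hM hC), div_le_iff₀ hC]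

/-- `SpectralRatioLe θ ⟺ ∀ universal F, logRatio F ≤ θ`. [folklore] -/
theorem spectralRatioLe_iff_forall_logRatio_le {θ : ℝ} :
    SpectralRatioLe θ ↔ ∀ F : SpectralMap ℂ, IsUniversalSpectralPoint ℂ F → logRatio F ≤ θ :=
  ⟨fun h F hF => (logRatio_le_iff hF).2 (h F hF), fun h F hF => (logRatio_le_iff hF).1 (h F hF)⟩

/-- **`logRatio F = (θ₁+θ₂+θ₃)(F) − log₂ F(C₁)`** in Alman–Li coordinates. [cite: AlmanLi2026, Prop. 4.2] -/
theorem logRatio_eq_sum_specMMPoint_sub {F : SpectralMap ℂ} (hF : IsUniversalSpectralPoint ℂ F) :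
    logRatio F = (∑ i, specMMPoint ℂ F i) - Real.logb 2 (F coupling₁) := by
  have hC : (0 : ℝ) < F coupling₁ := lt_of_lt_of_le (by norm_num) (four_le_map_coupling₁ hF)
  have hM : (0 : ℝ) < F (matMulTensor ℂ 2 2 2) := lt_of_lt_of_le (by norm_num) (OutsiderSandwichEdgeRigidity.four_le_map_matMulTensor_two hF)
  rw [logRatio, Real.logb_div hM.ne' hC.ne', map_matMul_eq_rpow hF,
    Real.logb_rpow (by norm_num) (by norm_num)]

/-- `2 ≤ log₂ F(C₁)`, hence `logRatio F ≤ (θ₁+θ₂+θ₃)(F) − 2 ≤ ω − 2`. [cite: AlmanLi2026, Prop. 4.2] -/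
theorem logRatio_le_sum_specMMPoint_sub_two {F : SpectralMap ℂ} (hF : IsUniversalSpectralPoint ℂ F) :
    logRatio F ≤ (∑ i, specMMPoint ℂ F i) - 2 := by
  rw [logRatio_eq_sum_specMMPoint_sub hF]
  have h2 : (2 : ℝ) ≤ Real.logb 2 (F coupling₁) := by
    rw [Real.le_logb_iff_rpow_le (by norm_num) (lt_of_lt_of_le (by norm_num) (four_le_map_coupling₁ hF))]
    norm_num
    exact four_le_map_coupling₁ hF
  linarith

/-! ## 1. Certificates bound every spectral point -/

/-- **`Helped N B ⟹ F⟨2,2,2⟩^N ≤ B · F(C₁)^N`** at every universal point. [cite: Strassen1988, Thm. 3.8] -/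
theorem pow_le_of_helped {N B : ℕ} (h : Helped N B) {F : SpectralMap ℂ}
    (hF : IsUniversalSpectralPoint ℂ F) :
    F (matMulTensor ℂ 2 2 2) ^ N ≤ (B : ℝ) * F coupling₁ ^ N := by
  have hm := hF.mono _ _ h
  rwa [hF.map_kronecker, hF.map_kroneckerPow, hF.map_kroneckerPow, hF.map_unitTensor] at hm

/-- **`(F⟨2,2,2⟩ / F(C₁))^N ≤ r(N)`** for every universal point and every `N`: a single point with
`F⟨2,2,2⟩ > F(C₁)` makes the exchange numbers grow exponentially. [cite: Strassen1988, Thm. 3.8] -/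
theorem ratio_pow_le_exchangeNumber (N : ℕ) {F : SpectralMap ℂ} (hF : IsUniversalSpectralPoint ℂ F) :
    (F (matMulTensor ℂ 2 2 2) / F coupling₁) ^ N ≤ exchangeNumber N := by
  have hC : (0 : ℝ) < F coupling₁ := lt_of_lt_of_le (by norm_num) (four_le_map_coupling₁ hF)
  rw [div_pow, div_le_iff₀ (pow_pos hC N)]
  exact pow_le_of_helped (helped_exchangeNumber N) hF

/-- **An achieved rate bounds the spectral ratio**: a certificate `Helped N B` with `B ≤ 2^{θN}` (`N ≥ 1`)
gives `F⟨2,2,2⟩ ≤ 2^θ F(C₁)` at every universal point (`N`-th roots). [cite: Strassen1988, Thm. 3.8] -/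
theorem spectralRatioLe_of_helped {N B : ℕ} {θ : ℝ} (hN : 1 ≤ N) (h : Helped N B)
    (hB : (B : ℝ) ≤ (2 : ℝ) ^ (θ * N)) : SpectralRatioLe θ := by
  intro F hF
  have ht0 : 0 ≤ F coupling₁ := hF.nonneg _
  have hm := pow_le_of_helped h hF
  have hN0 : N ≠ 0 := by omega
  have e2 : (2 : ℝ) ^ (θ * N) = ((2 : ℝ) ^ θ) ^ N := Real.rpow_mul_natCast (by norm_num) _ _
  rw [e2] at hB
  have hpow : F (matMulTensor ℂ 2 2 2) ^ N ≤ ((2 : ℝ) ^ θ * F coupling₁) ^ N :=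
    calc F (matMulTensor ℂ 2 2 2) ^ N ≤ (B : ℝ) * F coupling₁ ^ N := hm
      _ ≤ ((2 : ℝ) ^ θ) ^ N * F coupling₁ ^ N := mul_le_mul_of_nonneg_right hB (pow_nonneg ht0 N)
      _ = ((2 : ℝ) ^ θ * F coupling₁) ^ N := by rw [mul_pow]
  exact le_of_pow_le_pow_left₀ hN0 (by positivity) hpow

/-- `ExponentAchieved θ ⟹ SpectralRatioLe θ`. [cite: Strassen1988, Thm. 3.8] -/
theorem spectralRatioLe_of_exponentAchieved {θ : ℝ} (h : ExponentAchieved θ) : SpectralRatioLe θ := by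
  obtain ⟨N, hN, B, hB, hle⟩ := h 1
  exact spectralRatioLe_of_helped hN hB hle

/-- Everything above `θ⋆` bounds the spectral ratio. [cite: Strassen1988, Thm. 3.8] -/
theorem spectralRatioLe_of_exchangeExponent_lt {θ : ℝ} (h : exchangeExponent < θ) : SpectralRatioLe θ :=
  spectralRatioLe_of_exponentAchieved (exponentAchieved_of_exchangeExponent_lt h)

/-! ## 2. Strassen duality with rates: spectral bounds give certificates -/

/-- **`SpectralRatioLe θ ⟹ ExponentAchieved (θ + ε)`** (`ε > 0`): choose `q > 2/ε`, `p = ⌈θq⌉`; then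
`F(⟨2,2,2⟩^{⊠q}) ≤ F(⟨2^p⟩ ⊠ C₁^{⊠q})` at every universal point, so by the spectral theorem (cofinal form)
`⟨B⟩ ⊠ (⟨2^p⟩ ⊠ C₁^{⊠q})^{⊠N} ⊵ (⟨2,2,2⟩^{⊠q})^{⊠N}` with `B ≤ 2^{(εq/2)N}` cofinally, i.e.
`Helped (qN) (B·2^{pN})` at rate `≤ θ + ε`. [cite: Strassen1988, Thm. 3.8] -/
theorem exponentAchieved_of_spectralRatioLe {θ ε : ℝ} (h : SpectralRatioLe θ) (hε : 0 < ε) :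
    ExponentAchieved (θ + ε) := by
  have hθ : 0 ≤ θ := h.nonneg
  -- parameters `q > 2/ε`, `p = ⌈θ q⌉`
  obtain ⟨q, hq⟩ : ∃ q : ℕ, 2 / ε < q := exists_nat_gt _
  have hqpos : (0 : ℝ) < q := lt_trans (by positivity) hq
  have hq1 : 1 ≤ q := by exact_mod_cast (show (0 : ℝ) < q from hqpos)
  have hq2 : (1 : ℝ) ≤ ε * q / 2 := by
    rw [div_lt_iff₀ hε] at hq
    linarith
  set p : ℕ := ⌈θ * q⌉₊ with hp
  have hp1 : θ * q ≤ p := Nat.le_ceil _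
  have hp2 : (p : ℝ) < θ * q + 1 := Nat.ceil_lt_add_one (mul_nonneg hθ hqpos.le)
  -- the spectral comparison for the pair (⟨2,2,2⟩^{⊠q}, ⟨2^p⟩ ⊠ C₁^{⊠q})
  have hspec : ∀ F : SpectralMap ℂ, IsUniversalSpectralPoint ℂ F →
      F (kroneckerPow (matMulTensor ℂ 2 2 2) q) ≤
        F (kroneckerTensor (unitTensor ℂ (2 ^ p)) (kroneckerPow coupling₁ q)) := by
    intro F hF
    have hM0 : 0 ≤ F (matMulTensor ℂ 2 2 2) := hF.nonneg _
    have hC0 : 0 ≤ F coupling₁ := hF.nonneg _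
    rw [hF.map_kroneckerPow, hF.map_kronecker, hF.map_kroneckerPow, hF.map_unitTensor]
    calc F (matMulTensor ℂ 2 2 2) ^ q ≤ ((2 : ℝ) ^ θ * F coupling₁) ^ q :=
          pow_le_pow_left₀ hM0 (h F hF) q
      _ = (2 : ℝ) ^ (θ * q) * F coupling₁ ^ q := by
          rw [mul_pow, Real.rpow_mul_natCast (by norm_num : (0 : ℝ) ≤ 2)]
      _ ≤ (2 : ℝ) ^ (p : ℝ) * F coupling₁ ^ q :=
          mul_le_mul_of_nonneg_right (Real.rpow_le_rpow_of_exponent_le (by norm_num) hp1)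
            (pow_nonneg hC0 q)
      _ = ((2 ^ p : ℕ) : ℝ) * F coupling₁ ^ q := by
          rw [Real.rpow_natCast]
          push_cast
          ring
  have hcof := (OutsiderSandwichBlockOneOperational.forall_universal_le_iff_cofinal
    (kroneckerPow (matMulTensor ℂ 2 2 2) q)
    (kroneckerTensor (unitTensor ℂ (2 ^ p)) (kroneckerPow coupling₁ q))).1 hspec
  have hε' : 0 < ε * q / 2 := by positivity
  intro N₀
  obtain ⟨N, hN, B, hres, hB⟩ := hcof (ε * q / 2) hε' N₀
  refine ⟨q * N, ?_, B * 2 ^ (p * N), ?_, ?_⟩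
  · calc N₀ ≤ N := hN
      _ = 1 * N := (one_mul N).symm
      _ ≤ q * N := Nat.mul_le_mul_right N hq1
  · -- the certificate, read in `T(ℂ)`
    rw [helped_iff_le]
    have hle := TensorClass.mk_le_mk_iff.2 hres
    have e1 : TensorClass.mk (kroneckerPow (kroneckerPow (matMulTensor ℂ 2 2 2) q) N) =
        TensorClass.mk (matMulTensor ℂ 2 2 2) ^ (q * N) := by
      rw [← TensorClass.mk_pow, ← TensorClass.mk_pow, ← pow_mul]
    have e2 : TensorClass.mk (kroneckerTensor (unitTensor ℂ B)
        (kroneckerPow (kroneckerTensor (unitTensor ℂ (2 ^ p)) (kroneckerPow coupling₁ q)) N)) =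
        ((B * 2 ^ (p * N) : ℕ) : TensorClass ℂ) * TensorClass.mk coupling₁ ^ (q * N) := by
      rw [← TensorClass.mk_mul_mk, ← TensorClass.natCast_eq_mk, ← TensorClass.mk_pow,
        ← TensorClass.mk_mul_mk, ← TensorClass.natCast_eq_mk, ← TensorClass.mk_pow]
      push_cast
      ring
    rwa [e1, e2] at hle
  · -- the count `B 2^{pN} ≤ 2^{(θ+ε) qN}`
    have hNr : (0 : ℝ) ≤ N := Nat.cast_nonneg N
    have hexp : ε * q / 2 * N + p * N ≤ (θ + ε) * ((q * N : ℕ) : ℝ) := by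
      push_cast
      have h1 : (p : ℝ) * N ≤ (θ * q + ε * q / 2) * N :=
        mul_le_mul_of_nonneg_right (by linarith) hNr
      nlinarith
    calc ((B * 2 ^ (p * N) : ℕ) : ℝ) = (B : ℝ) * (2 : ℝ) ^ (((p * N : ℕ) : ℝ)) := by
          rw [Real.rpow_natCast]; push_cast; ring
      _ ≤ (2 : ℝ) ^ (ε * q / 2 * N) * (2 : ℝ) ^ (((p * N : ℕ) : ℝ)) :=
          mul_le_mul_of_nonneg_right hB (by positivity)
      _ = (2 : ℝ) ^ (ε * q / 2 * N + p * N) := by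
          rw [← Real.rpow_add (by norm_num : (0 : ℝ) < 2)]; push_cast; ring_nf
      _ ≤ (2 : ℝ) ^ ((θ + ε) * ((q * N : ℕ) : ℝ)) :=
          Real.rpow_le_rpow_of_exponent_le (by norm_num) hexp

/-- `SpectralRatioLe θ ⟹ θ⋆ ≤ θ`. [cite: Strassen1988, Thm. 3.8] -/
theorem exchangeExponent_le_of_spectralRatioLe {θ : ℝ} (h : SpectralRatioLe θ) :
    exchangeExponent ≤ θ :=
  le_of_forall_pos_le_add fun _ hε => exchangeExponent_le (exponentAchieved_of_spectralRatioLe h hε)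

/-! ## 3. The spectral formula for `θ⋆` -/

/-- `SpectralRatioLe` is closed from above (continuity of `x ↦ 2^x`). [folklore] -/
theorem spectralRatioLe_of_forall_gt {θ : ℝ} (h : ∀ θ' : ℝ, θ < θ' → SpectralRatioLe θ') :
    SpectralRatioLe θ := by
  intro F hF
  have hlim : Tendsto (fun θ' : ℝ => (2 : ℝ) ^ θ' * F coupling₁) (𝓝[>] θ)
      (𝓝 ((2 : ℝ) ^ θ * F coupling₁)) := by
    have hc : ContinuousAt (fun x : ℝ => (2 : ℝ) ^ x) θ := Real.continuousAt_const_rpow (by norm_num)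
    exact (hc.tendsto.mono_left nhdsWithin_le_nhds).mul_const _
  refine ge_of_tendsto hlim ?_
  filter_upwards [self_mem_nhdsWithin] with θ' hθ' using h θ' hθ' F hF

/-- **Every universal point satisfies `F⟨2,2,2⟩ ≤ 2^{θ⋆} · F(C₁)`.** [cite: Strassen1988, Thm. 3.8] -/
theorem spectralRatioLe_exchangeExponent : SpectralRatioLe exchangeExponent :=
  spectralRatioLe_of_forall_gt fun _ h => spectralRatioLe_of_exchangeExponent_lt h

/-- **`θ⋆ = min {θ | ∀ universal F, F⟨2,2,2⟩ ≤ 2^θ F(C₁)}`** (attained). [cite: Strassen1988, Thm. 3.8] -/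
theorem isLeast_exchangeExponent_spectral : IsLeast {θ : ℝ | SpectralRatioLe θ} exchangeExponent :=
  ⟨spectralRatioLe_exchangeExponent, fun _ hθ => exchangeExponent_le_of_spectralRatioLe hθ⟩

/-- `θ⋆ = sInf {θ | SpectralRatioLe θ}`. [cite: Strassen1988, Thm. 3.8] -/
theorem exchangeExponent_eq_sInf_spectral : exchangeExponent = sInf {θ : ℝ | SpectralRatioLe θ} :=
  (isLeast_exchangeExponent_spectral.csInf_eq).symm

/-- `SpectralRatioLe θ ⟺ θ⋆ ≤ θ`. [cite: Strassen1988, Thm. 3.8] -/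
theorem spectralRatioLe_iff_exchangeExponent_le {θ : ℝ} : SpectralRatioLe θ ↔ exchangeExponent ≤ θ :=
  ⟨exchangeExponent_le_of_spectralRatioLe, fun h => spectralRatioLe_exchangeExponent.mono h⟩

/-- **Lower bounds from points: `log₂ (F⟨2,2,2⟩ / F(C₁)) ≤ θ⋆`** for every universal `F`.
[cite: Strassen1988, Thm. 3.8] -/
theorem logRatio_le_exchangeExponent {F : SpectralMap ℂ} (hF : IsUniversalSpectralPoint ℂ F) :
    logRatio F ≤ exchangeExponent :=
  (logRatio_le_iff hF).2 (spectralRatioLe_exchangeExponent F hF)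

/-- **THE SPECTRAL FORMULA `θ⋆ = sup_F log₂ (F⟨2,2,2⟩ / F(C₁))`** over the universal spectral points
(least upper bound; the gauge point contributes `0`). [cite: Strassen1988, Thm. 3.8] -/
theorem isLUB_exchangeExponent_logRatio :
    IsLUB {x : ℝ | ∃ F : SpectralMap ℂ, IsUniversalSpectralPoint ℂ F ∧ logRatio F = x}
      exchangeExponent := by
  refine ⟨?_, ?_⟩
  · rintro x ⟨F, hF, rfl⟩
    exact logRatio_le_exchangeExponent hF
  · intro b hb
    exact exchangeExponent_le_of_spectralRatioLe
      (spectralRatioLe_iff_forall_logRatio_le.2 fun F hF => hb ⟨F, hF, rfl⟩)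

/-- `θ⋆ = sSup {logRatio F | F universal}`. [cite: Strassen1988, Thm. 3.8] -/
theorem exchangeExponent_eq_sSup_logRatio :
    exchangeExponent =
      sSup {x : ℝ | ∃ F : SpectralMap ℂ, IsUniversalSpectralPoint ℂ F ∧ logRatio F = x} :=
  (isLUB_exchangeExponent_logRatio.csSup_eq
    ⟨0, gaugePoint₁ ℂ, gaugePoint₁_isUniversalSpectralPoint ℂ, logRatio_gaugePoint₁⟩).symm

/-- In coordinates: **`θ⋆ = sup_F [(θ₁+θ₂+θ₃)(F) − log₂ F(C₁)]`** — upper-bound half usable pointwise.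
[cite: AlmanLi2026, Prop. 4.2] -/
theorem sum_specMMPoint_sub_logb_le_exchangeExponent {F : SpectralMap ℂ}
    (hF : IsUniversalSpectralPoint ℂ F) :
    (∑ i, specMMPoint ℂ F i) - Real.logb 2 (F coupling₁) ≤ exchangeExponent := by
  rw [← logRatio_eq_sum_specMMPoint_sub hF]
  exact logRatio_le_exchangeExponent hF

/-- **The leaf, four ways**: `BlockOneIsMM ⟺ SpectralRatioLe 0 ⟺ θ⋆ = 0 ⟺ ∀ F, logRatio F ≤ 0`.
[cite: Strassen1988, Thm. 3.8] -/
theorem spectralRatioLe_zero_iff_exchangeExponent_eq_zero : SpectralRatioLe 0 ↔ exchangeExponent = 0 := by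
  rw [spectralRatioLe_iff_exchangeExponent_le]
  exact ⟨fun h => le_antisymm h exchangeExponent_nonneg, fun h => h.le⟩

/-- `BlockOneIsMM ⟺ SpectralRatioLe 0`. [cite: Strassen1988, Thm. 3.8] -/
theorem blockOneIsMM_iff_spectralRatioLe_zero :
    Theses.OutsiderSandwich.BlockOneIsMM ↔ SpectralRatioLe 0 := by
  rw [blockOneIsMM_iff_exchangeExponent_eq_zero, spectralRatioLe_zero_iff_exchangeExponent_eq_zero]

/-- **THE LEAF IN ALMAN–LI COORDINATES: `BlockOneIsMM ⟺ ∀ universal F, θ₁+θ₂+θ₃ ≤ log₂ F(C₁)`**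
(compare `ω = 2 ⟺ θ₁+θ₂+θ₃ ≡ 2`, and `log₂ F(C₁) ≥ 2` always). [cite: AlmanLi2026, Prop. 4.2] -/
theorem blockOneIsMM_iff_forall_sum_specMMPoint_le :
    Theses.OutsiderSandwich.BlockOneIsMM ↔ ∀ F : SpectralMap ℂ, IsUniversalSpectralPoint ℂ F →
      (∑ i, specMMPoint ℂ F i) ≤ Real.logb 2 (F coupling₁) := by
  rw [blockOneIsMM_iff_spectralRatioLe_zero, spectralRatioLe_iff_forall_logRatio_le]
  refine forall₂_congr fun F hF => ?_
  rw [logRatio_eq_sum_specMMPoint_sub hF, sub_nonpos]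

/-- **A minimal counterexample to the leaf is a universal spectral point**:
`¬ BlockOneIsMM ⟺ ∃ universal F, F(C₁) < F⟨2,2,2⟩` — and then `θ⋆ ≥ logRatio F > 0` and
`r(N) ≥ (F⟨2,2,2⟩/F(C₁))^N` for all `N`. [cite: Strassen1988, Thm. 3.8] -/
theorem not_blockOneIsMM_iff_exists_point :
    ¬ Theses.OutsiderSandwich.BlockOneIsMM ↔
      ∃ F : SpectralMap ℂ, IsUniversalSpectralPoint ℂ F ∧ F coupling₁ < F (matMulTensor ℂ 2 2 2) := by
  rw [blockOneIsMM_iff_spectralRatioLe_zero, spectralRatioLe_zero_iff]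
  simp only [not_forall, not_le, exists_prop]

/-- `ω = 2 ⟹` every universal point has `F⟨2,2,2⟩ ≤ F(C₁)`. [cite: Strassen1988, Thm. 3.8] -/
theorem spectralRatioLe_zero_of_summit (hS : _root_.MatrixMultiplication) : SpectralRatioLe 0 :=
  spectralRatioLe_zero_iff_exchangeExponent_eq_zero.2 (exchangeExponent_eq_zero_of_summit hS)

/-- **Summit ⟺ (no universal point separates `⟨2,2,2⟩` above `C₁`) ∧ CouplingMergeOptimal.**
[cite: Strassen1988, Thm. 3.8] -/
theorem summit_iff_spectral :
    _root_.MatrixMultiplication ↔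
      (∀ F : SpectralMap ℂ, IsUniversalSpectralPoint ℂ F → logRatio F ≤ 0) ∧
        Theses.OutsiderSandwich.CouplingMergeOptimal := by
  rw [summit_iff_exchangeExponent, ← spectralRatioLe_zero_iff_exchangeExponent_eq_zero,
    spectralRatioLe_iff_forall_logRatio_le]

end Summit.MatrixMultiplication.MatrixMultiplication.Theorems.OutsiderSandwichExchangeSpectral

end
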